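import Summits.QuantumFields.YangMills.Theorems.BalabanUVNodesN07P0FixedPointIsRecordMinimiserAtBgScheme
import Literature.MathematicalPhysics.QuantumFieldTheory.Balaban1983to89.Node00.BackgroundMapOfRecordChart

/-!
# N07 ∕ P0 — «[15] THEOREM 1 AS A NAMED MAP», THE KNIT — PART III: AT def-Y's CHART MAP `BgScheme.chart` (✓p811738 `Node00/BackgroundMapOfRecordChart`):
# Part II with the abstract chart PINNED to `Φ := S.chart V` («A ↦ exp(i·ev(A + 𝔄 V))·U₀»), so the link binders DISAPPEAR (`S.chart_sol V : S.chart V (S.sol V) = S.chartCfg V`, `rfl`;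
# `gaugeAct_one'`): tokens (rng)(cov)(c→s)(min) AT THE CHART MAP OF RECORD + `S.RegimeTok` ⟹ `UniqueUkOrbit … V`, `IsBackground … V (S.chartCfg V)` (gauge transform `u = 1`),
# `S.Prop7Tok ε` ∕ `S.UniqTok ε`, and `UkSel F N K k ε V = rootGauge k (S.chartCfg V)` — №509 (A)'s named map with NO auxiliary binder left

Cell `pub-ymgap` (YM-PLAN Track A, D-0062), width seat `pub-ymgap-dag-n07-w3` (g23).  `--kind proof --supports stmt-QuantumFields-27930 --as helper`, COUNT-NEUTRAL.  NEW leaf; theorems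
only — 0 `def`, 0 `sorry`; standard axioms.  Imports Part II ✓p811739 (⊇ Part I ✓p811578, def-Y ✓p811606) and def-Y's chart-map supply ✓p811738; nothing there edited.
[15] = [Balaban1985Variational]; [I] = [Balaban1987RG1].

CONTENTS (at `S : BgScheme F N 𝒴 𝒵 K k`, `V ∈ S.dom`, chart set `Kc : Set 𝒴`, chart map `S.chart V`, distinguished point `S.sol V`):
`uniqueUkOrbit_of_tokens_chart` · `isBackground_chartCfg_of_tokens_chart` (⟹ `IsBackground (avOfRecord F N K) (bgReg F N K k ε) k V (S.chartCfg V)` — the chart image of the fixed point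
ITSELF is the minimiser of record under (rng); def-Y's `Prop7Tok` asks only `∃ u`) · `prop7Tok_of_tokens_chart` ∕ `uniqTok_of_tokens_chart` (def-Y's two TOKENS derived, charts `S.chart V`,
sets `KcV V`) · ★★★ `ukSel_eq_rootGauge_chartCfg_of_tokens_chart` (`UkSel F N K k ε V = rootGauge k (S.chartCfg V)`, `k ≤ m + K`).
The displayed tokens now read, at def-Y's names: (rng) `∀ A ∈ Kc, S.chart V A ∈ bgReg F N K k ε ∧ Ū^k (S.chart V A) = V`; (cov) `∀ U ∈ bgReg, Ū^k U = V → ∃ A ∈ Kc, OrbitRel k (S.chart V A) U`;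
(c→s) `∀ A ∈ Kc, IsMinOn (wilsonAction4 ∘ S.chart V) Kc A → ‖A‖ ≤ S.ε₄ ∧ mapT (S.𝒢 V) 0 (S.W V) (S.J V) (S.𝔄 V) A = A`; (min) `S.sol V ∈ Kc ∧ IsMinOn (wilsonAction4 ∘ S.chart V) Kc (S.sol V)`.

HONEST FRAMING (binding).  Substitution only; (rng)(cov)(c→s)(min) + `S.RegimeTok` DISPLAYED, inhabited nowhere ((min)'s global step unprinted, D-B11-2; no lattice instance of
`BgScheme`, def-Y M1); nothing of [15] asserted; `UkExists ∕ UniqueUkOrbit ∕ hBg` NOT discharged unconditionally; N07 NOT discharged; P0 OPEN; 27930 ∕ 27931 ∕ 26648 ∕ K-Ax OPEN;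
COUNT 8∕28 · K 1∕4 UNMOVED; R4 = the CONDITIONAL finite-𝕋⁴ rung `BalabanLadder.UV` only — NOT continuum ∕ ℝ⁴ ∕ OS; the Yang–Mills mass gap (Clay) is NOT proved by any of this.
-/

noncomputable section

open Set

namespace Summit.QuantumFields.YangMills.Theorems.N07P0FixedPointIsRecordMinimiser

open Literature.MathematicalPhysics.QuantumFieldTheory.Balaban1983to89
open Literature.MathematicalPhysics.QuantumFieldTheory.Balaban1983to89.Node00
open Literature.MathematicalPhysics.QuantumFieldTheory.Balaban1983to89.T4Continuum (T4Family)
open Literature.MathematicalPhysics.QuantumFieldTheory.Balaban1983to89.B12GaugeOrbits021 (OrbitRel)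
open Literature.MathematicalPhysics.QuantumFieldTheory.Balaban1983to89.T4RootedResidualGauge (rootGauge)
open Literature.MathematicalPhysics.QuantumFieldTheory.Balaban1983to89.B11Prop6Scheme (mapT)
open Literature.MathematicalPhysics.QuantumFieldTheory.Balaban1983to89.B12RTGaugeInvariance254 (gaugeAct_one')
open GaugeField (gaugeAct)

variable {F : T4Family} {N : ℕ} [NeZero N] {𝒴 𝒵 : Type} [NormedAddCommGroup 𝒴] [NormedSpace ℂ 𝒴] [CompleteSpace 𝒴] [NormedAddCommGroup 𝒵] [NormedSpace ℂ 𝒵]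
variable {K k : ℕ} {S : BgScheme F N 𝒴 𝒵 K k} {ε : ℝ} {V : GaugeField (F.P K) k (SU N)} {Kc : Set 𝒴}

/-- **THE TOKENS AT THE CHART MAP OF RECORD ⟹ `UniqueUkOrbit F N K k ε V`** (Part II at `Φ := S.chart V`).
[cite: Balaban1985Variational, Thm 1 p.279, Prop. 6 p.295, (15) p.280, (26)–(28) p.282; Balaban1987RG1, (1.1) p.260] -/
theorem uniqueUkOrbit_of_tokens_chart (hR : S.RegimeTok) (hV : V ∈ S.dom)
    (range : ∀ A ∈ Kc, S.chart V A ∈ bgReg F N K k ε ∧ Averaging.iter (avOfRecord F N K) k (S.chart V A) = V)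
    (covers : ∀ U : GaugeField (F.P K) 0 (SU N), U ∈ bgReg F N K k ε → Averaging.iter (avOfRecord F N K) k U = V → ∃ A ∈ Kc, OrbitRel k (S.chart V A) U)
    (sol_of_isMinOn : ∀ A ∈ Kc, IsMinOn (wilsonAction4 ∘ S.chart V) Kc A → ‖A‖ ≤ S.ε₄ ∧ mapT (S.𝒢 V) 0 (S.W V) (S.J V) (S.𝔄 V) A = A)
    (star_mem : S.sol V ∈ Kc) (star_isMinOn : IsMinOn (wilsonAction4 ∘ S.chart V) Kc (S.sol V)) :
    UniqueUkOrbit F N K k ε V :=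
  uniqueUkOrbit_of_tokens_at hR hV range covers sol_of_isMinOn star_mem star_isMinOn

omit [CompleteSpace 𝒴] in
/-- **THE TOKENS AT THE CHART MAP OF RECORD ⟹ `IsBackground … V (S.chartCfg V)`** — the chart image of def-Y's fixed point IS a (0.21)-minimiser over `V` (no gauge transform needed under
(rng); `S.chart_sol V`). [cite: Balaban1985Variational, Thm 1 (8) p.279, Prop. 7 p.299, (142) p.299; Balaban1987RG1, (0.21) p.256] -/
theorem isBackground_chartCfg_of_tokens_chart
    (range : ∀ A ∈ Kc, S.chart V A ∈ bgReg F N K k ε ∧ Averaging.iter (avOfRecord F N K) k (S.chart V A) = V)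
    (covers : ∀ U : GaugeField (F.P K) 0 (SU N), U ∈ bgReg F N K k ε → Averaging.iter (avOfRecord F N K) k U = V → ∃ A ∈ Kc, OrbitRel k (S.chart V A) U)
    (star_mem : S.sol V ∈ Kc) (star_isMinOn : IsMinOn (wilsonAction4 ∘ S.chart V) Kc (S.sol V)) :
    IsBackground (avOfRecord F N K) (bgReg F N K k ε) k V (S.chartCfg V) := by
  rw [← S.chart_sol V]
  exact isBackground_chartPoint_of_tokens_at range covers star_mem star_isMinOn

omit [CompleteSpace 𝒴] in
/-- **def-Y's TOKEN `Prop7Tok` DERIVED at the chart maps of record** (`u := 1` by `gaugeAct_one'`; charts `S.chart V`, chart sets `KcV V`).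
[cite: Balaban1985Variational, Prop. 7 p.299, Prop. 8 p.304] -/
theorem prop7Tok_of_tokens_chart {KcV : GaugeField (F.P K) k (SU N) → Set 𝒴}
    (range : ∀ V ∈ S.dom, ∀ A ∈ KcV V, S.chart V A ∈ bgReg F N K k ε ∧ Averaging.iter (avOfRecord F N K) k (S.chart V A) = V)
    (covers : ∀ V ∈ S.dom, ∀ U : GaugeField (F.P K) 0 (SU N), U ∈ bgReg F N K k ε → Averaging.iter (avOfRecord F N K) k U = V →
      ∃ A ∈ KcV V, OrbitRel k (S.chart V A) U)
    (star_mem : ∀ V ∈ S.dom, S.sol V ∈ KcV V) (star_isMinOn : ∀ V ∈ S.dom, IsMinOn (wilsonAction4 ∘ S.chart V) (KcV V) (S.sol V)) :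
    S.Prop7Tok ε := fun V hV =>
  ⟨fun _ => 1, by
    rw [gaugeAct_one']
    exact isBackground_chartCfg_of_tokens_chart (range V hV) (covers V hV) (star_mem V hV) (star_isMinOn V hV)⟩

/-- **def-Y's TOKEN `UniqTok` DERIVED at the chart maps of record.** [cite: Balaban1985Variational, Thm 1 p.279, Prop. 6 p.295] -/
theorem uniqTok_of_tokens_chart (hR : S.RegimeTok) {KcV : GaugeField (F.P K) k (SU N) → Set 𝒴}
    (range : ∀ V ∈ S.dom, ∀ A ∈ KcV V, S.chart V A ∈ bgReg F N K k ε ∧ Averaging.iter (avOfRecord F N K) k (S.chart V A) = V)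
    (covers : ∀ V ∈ S.dom, ∀ U : GaugeField (F.P K) 0 (SU N), U ∈ bgReg F N K k ε → Averaging.iter (avOfRecord F N K) k U = V →
      ∃ A ∈ KcV V, OrbitRel k (S.chart V A) U)
    (sol_of_isMinOn : ∀ V ∈ S.dom, ∀ A ∈ KcV V, IsMinOn (wilsonAction4 ∘ S.chart V) (KcV V) A → ‖A‖ ≤ S.ε₄ ∧ mapT (S.𝒢 V) 0 (S.W V) (S.J V) (S.𝔄 V) A = A)
    (star_mem : ∀ V ∈ S.dom, S.sol V ∈ KcV V) (star_isMinOn : ∀ V ∈ S.dom, IsMinOn (wilsonAction4 ∘ S.chart V) (KcV V) (S.sol V)) :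
    S.UniqTok ε :=
  uniqTok_of_tokens hR range covers sol_of_isMinOn star_mem star_isMinOn

/-- **★★★ №509 (A)'s NAMED MAP AT THE CHART MAP OF RECORD, NO LINK BINDER**: the tokens at `S.chart V` + `S.RegimeTok` ⟹ `UkSel F N K k ε V = rootGauge k (S.chartCfg V)` (`k ≤ m + K`) —
«U_k of record = rooted gauge ∘ chart ∘ (Prop. 6's solution)» with the link discharged by `S.chart_sol V` (`rfl`).
[cite: Balaban1985Variational, Thm 1 p.279, Prop. 6 p.295, (174) p.305; Balaban1987RG1, (1.1) p.260, (2.3) p.265] -/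
theorem ukSel_eq_rootGauge_chartCfg_of_tokens_chart (hk : k ≤ (F.P K).m + (F.P K).K) (hR : S.RegimeTok) (hV : V ∈ S.dom)
    (range : ∀ A ∈ Kc, S.chart V A ∈ bgReg F N K k ε ∧ Averaging.iter (avOfRecord F N K) k (S.chart V A) = V)
    (covers : ∀ U : GaugeField (F.P K) 0 (SU N), U ∈ bgReg F N K k ε → Averaging.iter (avOfRecord F N K) k U = V → ∃ A ∈ Kc, OrbitRel k (S.chart V A) U)
    (sol_of_isMinOn : ∀ A ∈ Kc, IsMinOn (wilsonAction4 ∘ S.chart V) Kc A → ‖A‖ ≤ S.ε₄ ∧ mapT (S.𝒢 V) 0 (S.W V) (S.J V) (S.𝔄 V) A = A)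
    (star_mem : S.sol V ∈ Kc) (star_isMinOn : IsMinOn (wilsonAction4 ∘ S.chart V) Kc (S.sol V)) :
    UkSel F N K k ε V = rootGauge k (S.chartCfg V) :=
  ukSel_eq_rootGauge_chartCfg_of_tokens_at_eq hk hR hV range covers sol_of_isMinOn star_mem star_isMinOn (S.chart_sol V)

end Summit.QuantumFields.YangMills.Theorems.N07P0FixedPointIsRecordMinimiser

end
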